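import Literature.Algebra.Homology.ContCohomologyTransgressionKernel
import HarnessLib

/-!
# Classes in `H²` are represented by cocycles; the coboundary bounding a pulled-back class

Companion of `ContCohomologyTransgressionKernel.lean` (Mathlib's `continuousCohomology` of the
homogeneous continuous cochains in `TopModuleCat`, trivial coefficients `Λ`).  This proof-only file (no
definitions) supplies the two generic ingredients of the exactness of the five-term sequence at
`H²(G, Λ)` [cite: SerreGaloisCohomology1997, I §2.6 (b)] used by
`AbsTopIII/CcnTransgressionSurjective.lean` ([AbsTopIII] Prop. 1.4 (ii), surjectivity of the
differential):

* `homologyπ_two_surjective` — every class in `H²` is the class of a `2`-cocycle (the homology of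
  `TopModuleCat` is the concrete cokernel, whose projection is surjective);
* `d_twoCochain_apply`, `twoCochain_apply_eq`, `twoCocycle_one_one`, `twoCocycle_one_diag` — evaluation
  of `d²`, invariance, and the normalisations `F(1,1,b) = F(1,b,b) = F(1,1,1)` of a `2`-cocycle;
* `exists_oneCochain_of_pullback_eq_zero` — if `H²(G', Λ) = 0` then for a continuous homomorphism
  `θ : G' → G` and every `2`-cocycle `z` on `G` there is a continuous `g : G' → Λ` with
  `g(y e) = g(y) + g(e) − F(1, θ y, θ(y e))` (`F` the cochain of `z`; `g = σ(1, ·)` for a homogeneous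
  `1`-cochain `σ` with `d¹σ = θ^* F`).

Generic; no anabelian content.
-/

noncomputable section

open CategoryTheory CategoryTheory.Limits TopRep ContRepresentation Topology

/-! ### Generic: classes are represented by cocycles; the pulled-back coboundary -/

namespace ContinuousCohomology

universe u v w

section Generic

variable {k : Type u} [Ring k] [TopologicalSpace k]
variable {G : Type v} [Group G] [TopologicalSpace G] [IsTopologicalGroup G]
variable (X : TopRep.{max v w} k G)

/-- Every class in `H² = (homogeneousCochains X).homology 2` is the class of a `2`-cocycle (the
homology of `TopModuleCat` is the concrete cokernel `Z² ⧸ range(toCycles)`, whose projection is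
surjective). [cite: SerreGaloisCohomology1997, I §2.3] -/
theorem homologyπ_two_surjective :
    Function.Surjective ((homogeneousCochains X).homologyπ 2).hom := by
  have hc := (homogeneousCochains X).homologyIsCokernel 1 2 (by simp)
  have hc' := TopModuleCat.isColimitCoker ((homogeneousCochains X).toCycles 1 2)
  have hcomm := IsColimit.comp_coconePointUniqueUpToIso_hom hc hc' WalkingParallelPair.one
  rw [Cofork.app_one_eq_π, Cofork.app_one_eq_π, Cofork.π_ofπ, Cofork.π_ofπ] at hcomm
  have hcomm' : (homogeneousCochains X).homologyπ 2 ≫ (hc.coconePointUniqueUpToIso hc').hom =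
      TopModuleCat.cokerπ ((homogeneousCochains X).toCycles 1 2) := hcomm
  intro ξ
  obtain ⟨z, hz⟩ := TopModuleCat.cokerπ_surjective ((homogeneousCochains X).toCycles 1 2)
    ((hc.coconePointUniqueUpToIso hc').hom.hom ξ)
  refine ⟨z, ?_⟩
  have h2 := congrArg (fun ψ => TopModuleCat.Hom.hom ψ z) hcomm'
  change (hc.coconePointUniqueUpToIso hc').hom.hom (((homogeneousCochains X).homologyπ 2).hom z) =
    (TopModuleCat.cokerπ ((homogeneousCochains X).toCycles 1 2)).hom z at h2
  rw [hz] at h2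
  have hinj : Function.Injective (hc.coconePointUniqueUpToIso hc').hom.hom := by
    intro a b hab
    have := congrArg (hc.coconePointUniqueUpToIso hc').inv.hom hab
    simpa [← TopModuleCat.hom_comp, ← ConcreteCategory.comp_apply] using this
  exact hinj h2

end Generic

section Pullback

variable {G : Type v} [Group G] [TopologicalSpace G] [IsTopologicalGroup G]
  {G' : Type v} [Group G'] [TopologicalSpace G'] [IsTopologicalGroup G'] (θ : G' →ₜ* G)
  {Λ : Type v} [AddCommGroup Λ] [TopologicalSpace Λ] [IsTopologicalAddGroup Λ]

/-- The coboundary of a homogeneous `2`-cochain of the trivial module, evaluated: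
`(d² F)(x, y, z, w) = F(y,z,w) − (F(x,z,w) − (F(x,y,w) − F(x,y,z)))`.
[cite: SerreGaloisCohomology1997, I §2.3] -/
theorem d_twoCochain_apply (F : (homogeneousCochains (trivCoeff G Λ)).X 2) (x y z w : G) :
    (((homogeneousCochains (trivCoeff G Λ)).d 2 3).hom F).1 x y z w =
      F.1 y z w - (F.1 x z w - (F.1 x y w - F.1 x y z)) := by
  have h := homogeneousCochains.d_apply (trivCoeff G Λ) 2 F
  rw [h]
  rfl

/-- An invariant homogeneous `2`-cochain of the trivial module is determined by its values at
`(1, ·, ·)`: `F(x, y, w) = F(1, x⁻¹ y, x⁻¹ w)`. [cite: SerreGaloisCohomology1997, I §2.3] -/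
theorem twoCochain_apply_eq (F : (homogeneousCochains (trivCoeff G Λ)).X 2) (x y w : G) :
    F.1 x y w = F.1 1 (x⁻¹ * y) (x⁻¹ * w) := by
  have h := congrArg (fun c : C(G, C(G, C(G, Λ))) => c 1 (x⁻¹ * y) (x⁻¹ * w)) (F.2 x⁻¹)
  change F.1 (x⁻¹⁻¹ * 1) (x⁻¹⁻¹ * (x⁻¹ * y)) (x⁻¹⁻¹ * (x⁻¹ * w)) = F.1 1 (x⁻¹ * y) (x⁻¹ * w) at h
  rw [inv_inv, mul_one, mul_inv_cancel_left, mul_inv_cancel_left] at h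
  exact h

/-- For a `2`-COCYCLE `F` of the trivial module, `F(1, 1, ·)` is constant.
[cite: SerreGaloisCohomology1997, I §2.3] -/
theorem twoCocycle_one_one (F : (homogeneousCochains (trivCoeff G Λ)).X 2)
    (hF : ((homogeneousCochains (trivCoeff G Λ)).d 2 3).hom F = 0) (b : G) :
    F.1 1 1 b = F.1 1 1 1 := by
  have h := congrArg (fun c : (homogeneousCochains (trivCoeff G Λ)).X 3 => c.1 1 1 1 b) hF
  change (((homogeneousCochains (trivCoeff G Λ)).d 2 3).hom F).1 1 1 1 b = 0 at h
  rw [d_twoCochain_apply] at h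
  -- `F(1,1,b) - (F(1,1,b) - (F(1,1,b) - F(1,1,1))) = 0`
  have : F.1 1 1 b - F.1 1 1 1 = 0 := by
    rw [← h]
    abel
  exact sub_eq_zero.mp this

/-- For an invariant `2`-cocycle `F` of the trivial module, `F(1, b, b) = F(1, 1, 1)`.
[cite: SerreGaloisCohomology1997, I §2.3] -/
theorem twoCocycle_one_diag (F : (homogeneousCochains (trivCoeff G Λ)).X 2)
    (hF : ((homogeneousCochains (trivCoeff G Λ)).d 2 3).hom F = 0) (b : G) :
    F.1 1 b b = F.1 1 1 1 := by
  have h := congrArg (fun c : (homogeneousCochains (trivCoeff G Λ)).X 3 => c.1 1 b b b) hF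
  change (((homogeneousCochains (trivCoeff G Λ)).d 2 3).hom F).1 1 b b b = 0 at h
  rw [d_twoCochain_apply] at h
  -- `F(b,b,b) - (F(1,b,b) - (F(1,b,b) - F(1,b,b))) = 0`, and `F(b,b,b) = F(1,1,1)`
  have hbbb : F.1 b b b = F.1 1 1 1 := by
    rw [twoCochain_apply_eq (Λ := Λ) F b b b, inv_mul_cancel]
  have : F.1 1 b b - F.1 1 1 1 = 0 := by
    rw [← hbbb, ← neg_eq_zero, ← h]
    abel
  exact sub_eq_zero.mp this

/-- **The pulled-back class vanishes ⇒ an inhomogeneous `1`-cochain bounding it.**  If every class in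
`H²(G', Λ)` is zero, then for every `2`-cocycle `z` on `G` there is a continuous `g : G' → Λ` with
`g(y e) = g(y) + g(e) − F(1, θ y, θ y · θ e)` (`F` the cochain of `z`): the cochain of the pull-back
`θ^* z` is `d¹σ`, and `g := σ(1, ·)`. [cite: SerreGaloisCohomology1997, I §2.6 (b)] -/
theorem exists_oneCochain_of_pullback_eq_zero
    (hH2 : ∀ z' : (homogeneousCochains (trivCoeff G' Λ)).cycles 2,
      ((homogeneousCochains (trivCoeff G' Λ)).homologyπ 2).hom z' = 0)
    (z : (homogeneousCochains (trivCoeff G Λ)).cycles 2) :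
    ∃ g : C(G', Λ), ∀ y e : G',
      g (y * e) = g y + g e -
        (((homogeneousCochains (trivCoeff G Λ)).iCycles 2).hom z).1 1 (θ y) (θ y * θ e) := by
  -- the pulled-back cocycle and a bounding `1`-cochain
  let z' : (homogeneousCochains (trivCoeff G' Λ)).cycles 2 :=
    (HomologicalComplex.cyclesMap (cochainsMap θ (trivResHom Λ θ)) 2).hom z
  obtain ⟨σ, hσ⟩ := exists_toCycles_eq_of_π_two_eq_zero.{0, v, v} (trivCoeff G' Λ) z' (hH2 z')
  have hd : ((homogeneousCochains (trivCoeff G' Λ)).d 1 2).hom σ =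
      ((homogeneousCochains (trivCoeff G' Λ)).iCycles 2).hom z' := by
    have h := congrArg (fun ψ => ψ.hom σ) ((homogeneousCochains (trivCoeff G' Λ)).toCycles_i 1 2)
    simp only [TopModuleCat.hom_comp, ContinuousLinearMap.coe_comp, Function.comp_apply] at h
    rw [hσ] at h
    exact h.symm
  have hi := congrArg (fun ψ => ψ.hom z)
    (HomologicalComplex.cyclesMap_i (cochainsMap θ (trivResHom Λ θ)) 2)
  simp only [TopModuleCat.hom_comp, ContinuousLinearMap.coe_comp, Function.comp_apply] at hi
  have hev : ∀ x y w : G', σ.1 y w - (σ.1 x w - σ.1 x y) =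
      (((homogeneousCochains (trivCoeff G Λ)).iCycles 2).hom z).1 (θ x) (θ y) (θ w) := by
    intro x y w
    rw [← d_oneCochain_apply, hd]
    change (((homogeneousCochains (trivCoeff G' Λ)).iCycles 2).hom
      ((HomologicalComplex.cyclesMap (cochainsMap θ (trivResHom Λ θ)) 2).hom z)).1 x y w = _
    rw [hi]
    rfl
  refine ⟨σ.1 1, fun y e => ?_⟩
  have key := hev 1 y (y * e)
  rw [map_one θ, map_mul θ, oneCochain_apply_eq (Λ := Λ) σ y (y * e), inv_mul_cancel_left] at key
  rw [← key]
  abel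

end Pullback

end ContinuousCohomology
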